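import Summits.NavierStokesRegularity.NavierStokesRegularity.Theorems.AxisymmetricExtremalityAxisymmetricKatoGlobalStubSeregin2020TypeIILemma22ExcisionBallCutoffs
import Literature.Analysis.FluidPDE.AxisymmetricEuler
import Mathlib.MeasureTheory.Measure.Lebesgue.VolumeOfBalls
import HarnessLib

/-!
# Seregin 2020, Lemma 2.2: the three spatial costs of the product cut-off — L22-B, piece F3b.4 (spatial part)

Seat ns-es-p1 g3 (INPUTS A1 / L22-B; cut owner ns-inputs-plan g5; kit `A1-L22B-F3.md`).  For the product cut-off
`P = ∏_{i∈A}(1 - ψᵢ)` of `…Lemma22ExcisionBallCutoffs` (bumps `ψᵢ` of the balls `B(xᵢ, rᵢ)`: `C¹`, values in `[0,1]`,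
`‖Dψᵢ‖ ≤ C₀/rᵢ`, `Dψᵢ = 0` off `B(xᵢ, 4rᵢ)`), the three spatial integrals that the error terms of the cut energy inequality
reduce to (N–U 2012 (3.9) with `Θ·P` in place of `Θ`):

* `norm_fderiv_prodCut_le_sum_indicator` — `‖DP(y)‖ ≤ ∑_{i∈A} (C₀/rᵢ) 1_{B(xᵢ,4rᵢ)}(y)`;
* `integral_norm_fderiv_prodCut_sq_le` — `∫ ‖DP‖² ≤ 64|B₁| C₀² ∑_{i,j∈A} min(rᵢ,rⱼ)³/(rᵢrⱼ)` (+ integrability): the `|∇Θ_A|²` error;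
* `eLpNorm_fderiv_prodCut_le` — `‖DP‖_{L^{3/2}} ≤ (64|B₁|)^{2/3} C₀ ∑_{i∈A} rᵢ`: the drift error (Hölder against `‖U‖_{L³}`);
* `lintegral_norm_fderiv_prodCut_div_cylRadius_le` — `∫ ‖DP‖/ϱ ≤ 16 C_ax C₀ ∑_{i∈A} rᵢ` given `∫_{B(x₀,ρ)} ϱ⁻¹ ≤ C_ax ρ²`
  (the tree's `lintegral_inv_cylRadius_rpow_ball_le 1`, kept as a hypothesis so that this file stays route-independent):
  the axis-drift error.

Summed over the steps of the schedule with `∑_m |L_m| 1[i ∈ A_m] ≤ 4rᵢ²` (`sum_activeLength_le`) these are `O(∑rᵢ³ + (∑rᵢ²)²)`,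
`O(‖U‖₃ (∑ rᵢ³)^{2/3})`, `O(∑ rᵢ³)`.  WHAT THIS IS NOT: no statement about Navier–Stokes; no summit statement is proved here.
[NazarovUraltseva2012 §3 (3.9); Seregin2020 §3]
-/

-- the problem directory repeats the summit name (D-0017); core's `dupNamespace` linter fires
set_option linter.dupNamespace false

noncomputable section

open MeasureTheory Set Function Filter Topology TopologicalSpace Metric
open scoped NNReal ENNReal

namespace Summit.NavierStokesRegularity.NavierStokesRegularity.Theorems.AxisymmetricKatoGlobal.EulerScaling

open Literature.Analysis.FluidPDE

/-- Volume of a ball of radius `4ρ` in `ℝ³`: `64 ρ³ |B₁|`, `|B₁| = 4π/3`. [folklore] -/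
theorem volume_real_ball_four_mul (c : EuclideanSpace ℝ (Fin 3)) {ρ : ℝ} (hρ : 0 ≤ ρ) :
    volume.real (ball c (4 * ρ)) = 64 * (Real.pi * 4 / 3) * ρ ^ 3 := by
  rw [measureReal_def, EuclideanSpace.volume_ball_fin_three, ENNReal.toReal_mul, ← ENNReal.ofReal_pow (by positivity),
    ENNReal.toReal_ofReal (by positivity), ENNReal.toReal_ofReal (by positivity)]
  ring

/-- **`‖DP(y)‖ ≤ ∑_{i∈A} (C₀/rᵢ) 1_{B(xᵢ,4rᵢ)}(y)`.** [folklore] -/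
theorem norm_fderiv_prodCut_le_sum_indicator {A : Finset ℕ} {ψ : ℕ → EuclideanSpace ℝ (Fin 3) → ℝ}
    {x : ℕ → EuclideanSpace ℝ (Fin 3)} {r : ℕ → ℝ} {C₀ : ℝ}
    (hψ : ∀ i ∈ A, ContDiff ℝ 1 (ψ i)) (h0 : ∀ i ∈ A, ∀ y, 0 ≤ ψ i y) (h1 : ∀ i ∈ A, ∀ y, ψ i y ≤ 1)
    (hgrad : ∀ i ∈ A, ∀ y, ‖fderiv ℝ (ψ i) y‖ ≤ C₀ / r i)
    (hgrad0 : ∀ i ∈ A, ∀ y, y ∉ ball (x i) (4 * r i) → fderiv ℝ (ψ i) y = 0) (y : EuclideanSpace ℝ (Fin 3)) :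
    ‖fderiv ℝ (fun y => ∏ i ∈ A, (1 - ψ i y)) y‖ ≤ ∑ i ∈ A, (ball (x i) (4 * r i)).indicator (fun _ => C₀ / r i) y := by
  refine (norm_fderiv_prodCut_le hψ h0 h1 y).trans (Finset.sum_le_sum fun i hi => ?_)
  by_cases hy : y ∈ ball (x i) (4 * r i)
  · rw [indicator_of_mem hy]; exact hgrad i hi y
  · rw [indicator_of_notMem hy, hgrad0 i hi y hy, norm_zero]

/-- `DP` is continuous (`P` is `C¹`). [folklore] -/
theorem continuous_fderiv_prodCut {A : Finset ℕ} {ψ : ℕ → EuclideanSpace ℝ (Fin 3) → ℝ}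
    (hψ : ∀ i ∈ A, ContDiff ℝ 1 (ψ i)) : Continuous (fun y => fderiv ℝ (fun y => ∏ i ∈ A, (1 - ψ i y)) y) :=
  (contDiff_prodCut hψ).continuous_fderiv one_ne_zero

/-- **The `|∇Θ_A|²` cost:** `∫ ‖DP‖² ≤ 64|B₁| C₀² ∑_{i∈A}∑_{j∈A} min(rᵢ,rⱼ)³/(rᵢ rⱼ)`, and `‖DP‖²` is integrable
(`‖DP‖² ≤ ∑ᵢ∑ⱼ (C₀²/(rᵢrⱼ)) 1_{Bᵢ ∩ Bⱼ}`, `|Bᵢ ∩ Bⱼ| ≤ 64|B₁| min(rᵢ,rⱼ)³`). [cite: NazarovUraltseva2012, §3 (3.9)] -/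
theorem integral_norm_fderiv_prodCut_sq_le {A : Finset ℕ} {ψ : ℕ → EuclideanSpace ℝ (Fin 3) → ℝ}
    {x : ℕ → EuclideanSpace ℝ (Fin 3)} {r : ℕ → ℝ} {C₀ : ℝ} (hr : ∀ i ∈ A, 0 < r i) (hC₀ : 0 ≤ C₀)
    (hψ : ∀ i ∈ A, ContDiff ℝ 1 (ψ i)) (h0 : ∀ i ∈ A, ∀ y, 0 ≤ ψ i y) (h1 : ∀ i ∈ A, ∀ y, ψ i y ≤ 1)
    (hgrad : ∀ i ∈ A, ∀ y, ‖fderiv ℝ (ψ i) y‖ ≤ C₀ / r i)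
    (hgrad0 : ∀ i ∈ A, ∀ y, y ∉ ball (x i) (4 * r i) → fderiv ℝ (ψ i) y = 0) :
    Integrable (fun y => ‖fderiv ℝ (fun y => ∏ i ∈ A, (1 - ψ i y)) y‖ ^ 2) ∧
    ∫ y, ‖fderiv ℝ (fun y => ∏ i ∈ A, (1 - ψ i y)) y‖ ^ 2 ≤
      64 * (Real.pi * 4 / 3) * C₀ ^ 2 * ∑ i ∈ A, ∑ j ∈ A, min (r i) (r j) ^ 3 / (r i * r j) := by
  set P : EuclideanSpace ℝ (Fin 3) → ℝ := fun y => ∏ i ∈ A, (1 - ψ i y) with hP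
  set g : ℕ → ℕ → EuclideanSpace ℝ (Fin 3) → ℝ := fun i j =>
    (ball (x i) (4 * r i) ∩ ball (x j) (4 * r j)).indicator (fun _ => C₀ / r i * (C₀ / r j)) with hg
  -- pointwise majorant
  have hpt : ∀ y, ‖fderiv ℝ P y‖ ^ 2 ≤ ∑ i ∈ A, ∑ j ∈ A, g i j y := by
    intro y
    have h := norm_fderiv_prodCut_le_sum_indicator hψ h0 h1 hgrad hgrad0 y
    calc ‖fderiv ℝ P y‖ ^ 2 ≤ (∑ i ∈ A, (ball (x i) (4 * r i)).indicator (fun _ => C₀ / r i) y) ^ 2 :=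
          pow_le_pow_left₀ (norm_nonneg _) h 2
      _ = ∑ i ∈ A, ∑ j ∈ A, (ball (x i) (4 * r i)).indicator (fun _ => C₀ / r i) y *
            (ball (x j) (4 * r j)).indicator (fun _ => C₀ / r j) y := by rw [sq, Finset.sum_mul_sum]
      _ = ∑ i ∈ A, ∑ j ∈ A, g i j y := by
          refine Finset.sum_congr rfl fun i _ => Finset.sum_congr rfl fun j _ => ?_
          rw [hg]; exact (Set.inter_indicator_mul (fun _ => C₀ / r i) (fun _ => C₀ / r j) y).symm
  -- the majorant is integrable, with the stated integral bound
  have hgi : ∀ i ∈ A, ∀ j ∈ A, Integrable (g i j) := by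
    intro i _ j _
    rw [hg]
    exact (integrableOn_const (C := C₀ / r i * (C₀ / r j))
      ((measure_mono inter_subset_left).trans_lt measure_ball_lt_top).ne).integrable_indicator
      (measurableSet_ball.inter measurableSet_ball)
  have hgint : ∀ i ∈ A, ∀ j ∈ A, ∫ y, g i j y ≤ 64 * (Real.pi * 4 / 3) * C₀ ^ 2 * (min (r i) (r j) ^ 3 / (r i * r j)) := by
    intro i hi j hj
    rw [hg, integral_indicator_const _ (measurableSet_ball.inter measurableSet_ball), smul_eq_mul]
    have hri := hr i hi; have hrj := hr j hj
    have hvol : volume.real (ball (x i) (4 * r i) ∩ ball (x j) (4 * r j)) ≤ 64 * (Real.pi * 4 / 3) * min (r i) (r j) ^ 3 := by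
      rcases le_total (r i) (r j) with hle | hle
      · rw [min_eq_left hle, ← volume_real_ball_four_mul (x i) hri.le]
        exact measureReal_mono inter_subset_left measure_ball_lt_top.ne
      · rw [min_eq_right hle, ← volume_real_ball_four_mul (x j) hrj.le]
        exact measureReal_mono inter_subset_right measure_ball_lt_top.ne
    have hc : 0 ≤ C₀ / r i * (C₀ / r j) := by positivity
    calc volume.real (ball (x i) (4 * r i) ∩ ball (x j) (4 * r j)) * (C₀ / r i * (C₀ / r j))
        ≤ 64 * (Real.pi * 4 / 3) * min (r i) (r j) ^ 3 * (C₀ / r i * (C₀ / r j)) :=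
          mul_le_mul_of_nonneg_right hvol hc
      _ = 64 * (Real.pi * 4 / 3) * C₀ ^ 2 * (min (r i) (r j) ^ 3 / (r i * r j)) := by
          field_simp
  have hGi : Integrable (fun y => ∑ i ∈ A, ∑ j ∈ A, g i j y) :=
    integrable_finsetSum _ fun i hi => integrable_finsetSum _ fun j hj => hgi i hi j hj
  have hmeas : AEStronglyMeasurable (fun y => ‖fderiv ℝ P y‖ ^ 2) volume :=
    ((continuous_fderiv_prodCut hψ).norm.pow 2).aestronglyMeasurable
  have hInt : Integrable (fun y => ‖fderiv ℝ P y‖ ^ 2) :=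
    hGi.mono' hmeas (Eventually.of_forall fun y => by
      rw [Real.norm_of_nonneg (sq_nonneg _)]; exact hpt y)
  refine ⟨hInt, ?_⟩
  calc ∫ y, ‖fderiv ℝ P y‖ ^ 2 ≤ ∫ y, ∑ i ∈ A, ∑ j ∈ A, g i j y := integral_mono hInt hGi hpt
    _ = ∑ i ∈ A, ∑ j ∈ A, ∫ y, g i j y := by
        rw [integral_finsetSum _ fun i hi => integrable_finsetSum _ fun j hj => hgi i hi j hj]
        exact Finset.sum_congr rfl fun i hi => integral_finsetSum _ fun j hj => hgi i hi j hj
    _ ≤ ∑ i ∈ A, ∑ j ∈ A, 64 * (Real.pi * 4 / 3) * C₀ ^ 2 * (min (r i) (r j) ^ 3 / (r i * r j)) :=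
        Finset.sum_le_sum fun i hi => Finset.sum_le_sum fun j hj => hgint i hi j hj
    _ = 64 * (Real.pi * 4 / 3) * C₀ ^ 2 * ∑ i ∈ A, ∑ j ∈ A, min (r i) (r j) ^ 3 / (r i * r j) := by
        rw [Finset.mul_sum]; exact Finset.sum_congr rfl fun i _ => by rw [Finset.mul_sum]

/-- **The drift cost:** `‖DP‖_{L^{3/2}(ℝ³)} ≤ (64|B₁|)^{2/3} C₀ ∑_{i∈A} rᵢ` (Minkowski over the active balls; each bump
contributes `(C₀/rᵢ)|B(xᵢ,4rᵢ)|^{2/3}`). [cite: NazarovUraltseva2012, §3 (3.9)] -/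
theorem eLpNorm_fderiv_prodCut_le {A : Finset ℕ} {ψ : ℕ → EuclideanSpace ℝ (Fin 3) → ℝ}
    {x : ℕ → EuclideanSpace ℝ (Fin 3)} {r : ℕ → ℝ} {C₀ : ℝ} (hr : ∀ i ∈ A, 0 < r i) (hC₀ : 0 ≤ C₀)
    (hψ : ∀ i ∈ A, ContDiff ℝ 1 (ψ i)) (h0 : ∀ i ∈ A, ∀ y, 0 ≤ ψ i y) (h1 : ∀ i ∈ A, ∀ y, ψ i y ≤ 1)
    (hgrad : ∀ i ∈ A, ∀ y, ‖fderiv ℝ (ψ i) y‖ ≤ C₀ / r i)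
    (hgrad0 : ∀ i ∈ A, ∀ y, y ∉ ball (x i) (4 * r i) → fderiv ℝ (ψ i) y = 0) :
    eLpNorm (fun y => fderiv ℝ (fun y => ∏ i ∈ A, (1 - ψ i y)) y) (ENNReal.ofReal (3 / 2)) volume ≤
      ENNReal.ofReal ((64 * (Real.pi * 4 / 3)) ^ (2 / 3 : ℝ) * C₀ * ∑ i ∈ A, r i) := by
  have hp0 : ENNReal.ofReal (3 / 2) ≠ 0 := (ENNReal.ofReal_pos.2 (by norm_num)).ne'
  have hp1 : 1 ≤ ENNReal.ofReal (3 / 2) := ENNReal.one_le_ofReal.2 (by norm_num)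
  set G : ℕ → EuclideanSpace ℝ (Fin 3) → ℝ := fun i => (ball (x i) (4 * r i)).indicator (fun _ => C₀ / r i) with hG
  have hle : ∀ y, ‖fderiv ℝ (fun y => ∏ i ∈ A, (1 - ψ i y)) y‖ ≤ (∑ i ∈ A, G i) y := by
    intro y; rw [Finset.sum_apply]; exact norm_fderiv_prodCut_le_sum_indicator hψ h0 h1 hgrad hgrad0 y
  refine (eLpNorm_mono_real hle).trans ((eLpNorm_sum_le (fun i _ =>
    aestronglyMeasurable_const.indicator measurableSet_ball) hp1).trans ?_)
  have hterm : ∀ i ∈ A, eLpNorm (G i) (ENNReal.ofReal (3 / 2)) volume ≤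
      ENNReal.ofReal ((64 * (Real.pi * 4 / 3)) ^ (2 / 3 : ℝ) * C₀ * r i) := by
    intro i hi
    have hri := hr i hi
    rw [hG, eLpNorm_indicator_const measurableSet_ball hp0 ENNReal.ofReal_ne_top, ENNReal.toReal_ofReal (by norm_num),
      EuclideanSpace.volume_ball_fin_three, Real.enorm_eq_ofReal (div_nonneg hC₀ hri.le),
      ← ENNReal.ofReal_pow (by positivity), ← ENNReal.ofReal_mul (by positivity),
      ENNReal.ofReal_rpow_of_nonneg (by positivity) (by norm_num), ← ENNReal.ofReal_mul (div_nonneg hC₀ hri.le)]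
    refine ENNReal.ofReal_le_ofReal (le_of_eq ?_)
    have e1 : ((4 * r i) ^ 3 * (Real.pi * 4 / 3)) = (64 * (Real.pi * 4 / 3)) * r i ^ 3 := by ring
    have e2 : (r i ^ 3 : ℝ) ^ (1 / (3 / 2) : ℝ) = r i ^ 2 := by
      rw [← Real.rpow_natCast (r i) 3, ← Real.rpow_mul hri.le]; norm_num
    rw [e1, Real.mul_rpow (by positivity) (by positivity), e2]
    have e3 : (1 / (3 / 2) : ℝ) = 2 / 3 := by norm_num
    rw [e3]; field_simp
  calc ∑ i ∈ A, eLpNorm (G i) (ENNReal.ofReal (3 / 2)) volume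
      ≤ ∑ i ∈ A, ENNReal.ofReal ((64 * (Real.pi * 4 / 3)) ^ (2 / 3 : ℝ) * C₀ * r i) := Finset.sum_le_sum hterm
    _ = ENNReal.ofReal ((64 * (Real.pi * 4 / 3)) ^ (2 / 3 : ℝ) * C₀ * ∑ i ∈ A, r i) := by
        rw [Finset.mul_sum, ENNReal.ofReal_sum_of_nonneg fun i hi => by
          have := (hr i hi).le; positivity]

/-- `DP ∈ L^{3/2}(ℝ³)`. [folklore] -/
theorem memLp_fderiv_prodCut {A : Finset ℕ} {ψ : ℕ → EuclideanSpace ℝ (Fin 3) → ℝ}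
    {x : ℕ → EuclideanSpace ℝ (Fin 3)} {r : ℕ → ℝ} {C₀ : ℝ} (hr : ∀ i ∈ A, 0 < r i) (hC₀ : 0 ≤ C₀)
    (hψ : ∀ i ∈ A, ContDiff ℝ 1 (ψ i)) (h0 : ∀ i ∈ A, ∀ y, 0 ≤ ψ i y) (h1 : ∀ i ∈ A, ∀ y, ψ i y ≤ 1)
    (hgrad : ∀ i ∈ A, ∀ y, ‖fderiv ℝ (ψ i) y‖ ≤ C₀ / r i)
    (hgrad0 : ∀ i ∈ A, ∀ y, y ∉ ball (x i) (4 * r i) → fderiv ℝ (ψ i) y = 0) :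
    MemLp (fun y => fderiv ℝ (fun y => ∏ i ∈ A, (1 - ψ i y)) y) (ENNReal.ofReal (3 / 2)) volume :=
  ⟨(continuous_fderiv_prodCut hψ).aestronglyMeasurable,
    (eLpNorm_fderiv_prodCut_le hr hC₀ hψ h0 h1 hgrad hgrad0).trans_lt ENNReal.ofReal_lt_top⟩

/-- **The axis-drift cost:** if `∫_{B(x₀,ρ)} ϱ⁻¹ ≤ C_ax ρ²` for all balls (the tree's `lintegral_inv_cylRadius_rpow_ball_le`
with `q = 1`, after `Real.rpow_neg_one` and `ρ^{3-1} = ρ²`), then `∫ ‖DP‖/ϱ ≤ C_ax · 16 C₀ ∑_{i∈A} rᵢ`.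
[cite: NazarovUraltseva2012, §3 (3.9), §4 (arXiv p. 14)] -/
theorem lintegral_norm_fderiv_prodCut_div_cylRadius_le {Cax : ℝ≥0∞}
    (hCax : ∀ (x₀ : EuclideanSpace ℝ (Fin 3)) (ρ : ℝ), 0 < ρ →
      ∫⁻ y in ball x₀ ρ, ENNReal.ofReal ((cylRadius y)⁻¹) ≤ Cax * ENNReal.ofReal (ρ ^ 2))
    {A : Finset ℕ} {ψ : ℕ → EuclideanSpace ℝ (Fin 3) → ℝ}
    {x : ℕ → EuclideanSpace ℝ (Fin 3)} {r : ℕ → ℝ} {C₀ : ℝ} (hr : ∀ i ∈ A, 0 < r i) (hC₀ : 0 ≤ C₀)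
    (hψ : ∀ i ∈ A, ContDiff ℝ 1 (ψ i)) (h0 : ∀ i ∈ A, ∀ y, 0 ≤ ψ i y) (h1 : ∀ i ∈ A, ∀ y, ψ i y ≤ 1)
    (hgrad : ∀ i ∈ A, ∀ y, ‖fderiv ℝ (ψ i) y‖ ≤ C₀ / r i)
    (hgrad0 : ∀ i ∈ A, ∀ y, y ∉ ball (x i) (4 * r i) → fderiv ℝ (ψ i) y = 0) :
    ∫⁻ y, ENNReal.ofReal (‖fderiv ℝ (fun y => ∏ i ∈ A, (1 - ψ i y)) y‖ / cylRadius y) ≤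
      Cax * ENNReal.ofReal (16 * C₀ * ∑ i ∈ A, r i) := by
  have hmeasρ : Measurable fun y : EuclideanSpace ℝ (Fin 3) => ENNReal.ofReal ((cylRadius y)⁻¹) :=
    (continuous_cylRadius.measurable.inv).ennreal_ofReal
  -- pointwise: `‖DP‖/ϱ ≤ ∑ᵢ 1_{Bᵢ} (C₀/rᵢ) ϱ⁻¹`
  have hpt : ∀ y, ENNReal.ofReal (‖fderiv ℝ (fun y => ∏ i ∈ A, (1 - ψ i y)) y‖ / cylRadius y) ≤
      ∑ i ∈ A, (ball (x i) (4 * r i)).indicator (fun y => ENNReal.ofReal (C₀ / r i) * ENNReal.ofReal ((cylRadius y)⁻¹)) y := by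
    intro y
    have hρ := cylRadius_nonneg y
    have h := norm_fderiv_prodCut_le_sum_indicator hψ h0 h1 hgrad hgrad0 y
    calc ENNReal.ofReal (‖fderiv ℝ (fun y => ∏ i ∈ A, (1 - ψ i y)) y‖ / cylRadius y)
        ≤ ENNReal.ofReal ((∑ i ∈ A, (ball (x i) (4 * r i)).indicator (fun _ => C₀ / r i) y) * (cylRadius y)⁻¹) := by
          rw [div_eq_mul_inv]
          exact ENNReal.ofReal_le_ofReal (mul_le_mul_of_nonneg_right h (inv_nonneg.2 hρ))
      _ = ∑ i ∈ A, (ball (x i) (4 * r i)).indicator (fun y => ENNReal.ofReal (C₀ / r i) * ENNReal.ofReal ((cylRadius y)⁻¹)) y := by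
          rw [Finset.sum_mul, ENNReal.ofReal_sum_of_nonneg fun i hi => mul_nonneg
            (indicator_nonneg (fun _ _ => div_nonneg hC₀ (hr i hi).le) _) (inv_nonneg.2 hρ)]
          refine Finset.sum_congr rfl fun i hi => ?_
          by_cases hy : y ∈ ball (x i) (4 * r i)
          · rw [indicator_of_mem hy, indicator_of_mem hy, ENNReal.ofReal_mul (div_nonneg hC₀ (hr i hi).le)]
          · rw [indicator_of_notMem hy, indicator_of_notMem hy, zero_mul, ENNReal.ofReal_zero]
  refine (lintegral_mono hpt).trans ?_
  rw [lintegral_finsetSum A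
    (f := fun i y => (ball (x i) (4 * r i)).indicator
      (fun y => ENNReal.ofReal (C₀ / r i) * ENNReal.ofReal ((cylRadius y)⁻¹)) y)
    fun i _ => (hmeasρ.const_mul (ENNReal.ofReal (C₀ / r i))).indicator measurableSet_ball]
  have hterm : ∀ i ∈ A, ∫⁻ y, (ball (x i) (4 * r i)).indicator
      (fun y => ENNReal.ofReal (C₀ / r i) * ENNReal.ofReal ((cylRadius y)⁻¹)) y ≤ Cax * ENNReal.ofReal (16 * C₀ * r i) := by
    intro i hi
    have hri := hr i hi
    rw [lintegral_indicator measurableSet_ball, lintegral_const_mul _ hmeasρ]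
    have hball := hCax (x i) (4 * r i) (by positivity)
    calc ENNReal.ofReal (C₀ / r i) * ∫⁻ y in ball (x i) (4 * r i), ENNReal.ofReal ((cylRadius y)⁻¹)
        ≤ ENNReal.ofReal (C₀ / r i) * (Cax * ENNReal.ofReal ((4 * r i) ^ 2)) := by gcongr
      _ = Cax * ENNReal.ofReal (16 * C₀ * r i) := by
          rw [mul_left_comm, ← ENNReal.ofReal_mul (div_nonneg hC₀ hri.le)]
          congr 2; field_simp; ring
  calc ∑ i ∈ A, ∫⁻ y, (ball (x i) (4 * r i)).indicator
        (fun y => ENNReal.ofReal (C₀ / r i) * ENNReal.ofReal ((cylRadius y)⁻¹)) y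
      ≤ ∑ i ∈ A, Cax * ENNReal.ofReal (16 * C₀ * r i) := Finset.sum_le_sum hterm
    _ = Cax * ENNReal.ofReal (16 * C₀ * ∑ i ∈ A, r i) := by
        rw [← Finset.mul_sum, Finset.mul_sum A (fun i => r i) (16 * C₀), ENNReal.ofReal_sum_of_nonneg (fun i hi => by
          have := (hr i hi).le; positivity)]

end Summit.NavierStokesRegularity.NavierStokesRegularity.Theorems.AxisymmetricKatoGlobal.EulerScaling

end
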